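import Summits.HodgeConjecture.HodgeConjecture.Theses.EndoscopicMiddleDegree
import Literature.AlgebraicGeometry.Motives.HodgeClassesPotentiallyTate

/-!
# Crux `AlgebraicOrEnveloped` (stmt-HodgeConjecture-14943) · ideator 4, round 2 · idea `tate-line-seeding`

Typed shadow of the card's TRANSFER: the dichotomy of the crux ("algebraic OR enveloped") is re-cut at
POTENTIAL TATENESS. For a rational Hodge `(n,n)`-class `c` on `X` (with a `UnitaryBallQuotientDatum`),
"`c` is potentially Tate" (its rational Betti lift is fixed by an open subgroup of `Gal(K̄/K)` in
`H²ⁿ_ét(X₀ ⊗ K̄, ℚ_ℓ)(n)` for every finitely generated model `(K, X₀)` and every `ℓ` — the tree's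
`HodgeClassesArePotentiallyTate` vocabulary, class by class) is exactly the input the route's p-adic
engine (supersingular seeds + Bloch–Esnault–Kerz + ALG) consumes, because a Galois-stable line of
Hodge–Tate weight `n` is de Rham with `D_dR ⊂ Filⁿ` (the BEK Hodge condition ON THE LINE, no purity
of the Hecke block needed). So:

* `MiddleClassesPotentiallyTate E B C`  — every rational Hodge `(n,n)`-class on the sector is potentially
  Tate (AUTOMORPHIC SIDE + the honest residue: proved by the route's sieve/envelope for pure pieces,
  a theorem of Galois type for monomial cores once lifted, and exactly "Hodge ⟹ Tate-type" =
  CoreVanishing for Lie-irreducible cores; implied by the tree predicate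
  `HodgeClassesArePotentiallyTate E B C (2(m+1)) X`, Deligne/Charles–Schnell 11.2.17's Galois half);
* `PotentiallyTateMiddleClassesAlgebraic E B C` — potentially Tate rational Hodge `(n,n)`-classes on the
  sector are algebraic (p-ADIC SIDE: one uniform engine — Tate line ⟹ Filⁿ ⟹ Xiao–Zhu seeds at inert
  V-general primes ⟹ BEK ⟹ ALG; subsumes `IsotypicMiddleClassesAlgebraic` and the monomial cores);

and `algebraicOrEnveloped_of_potentiallyTate : (A′) → (B) → AlgebraicOrEnveloped` (kernel-checked
below; the last step is the standing disprover's F1 `Submodule.mem_sup_left`).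
-/

noncomputable section

namespace Summit.HodgeConjecture.HodgeConjecture.Cruxes.AlgebraicOrEnveloped.IdeatorFour

open CategoryTheory
open scoped TensorProduct
open Literature.AlgebraicGeometry Literature.AlgebraicGeometry.Motives
  Literature.AlgebraicGeometry.HodgeTheory Literature.AlgebraicGeometry.ShimuraVarieties
  Literature.AlgebraicTopology.SingularHomology
open Summit.HodgeConjecture.HodgeConjecture.Theses.EndoscopicMiddleDegree

variable (E : ∀ (K : Subfield ℂ) (ℓ : ℕ) [Fact ℓ.Prime], EtaleRealization K ℓ)
  (B : BettiHodgeData ℂ)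
  (C : ∀ (K : Subfield ℂ) (ℓ : ℕ) [Fact ℓ.Prime], ArtinComparison (E K ℓ) B K.subtype)

/-- CLASS-LEVEL potential Tateness (the body of the tree's `HodgeClassesArePotentiallyTate`,
specialised to one class `c ∈ H²ᵖ(X(ℂ); ℂ)`): for every rational Betti lift `t` of `c`, every
finitely generated model `(K, X₀, e)` and every prime `ℓ`, the Artin-comparison image of `1 ⊗ e^*t`
is a Tate class (fixed by an open subgroup of `Gal(K̄/K)` after the `p`-fold cyclotomic twist).
[cite: Deligne1982HodgeCycles, Prop. 2.9(b)] [cite: Tate1994, §1] -/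
def IsPotentiallyTateClass (n : ℕ) (X : SchemeOver ℂ) (p : ℕ) (c : complexBetti X (2 * p)) : Prop :=
  ∀ (t : B.W.obj X (2 * p)) (ζ : singularCochainComplex.cocycles ℚ ℚ (ComplexPoints X) (2 * p)),
    singularCohomology.π ℚ ℚ (ComplexPoints X) (2 * p) ζ = B.isoObj X (2 * p) t →
    singularCohomology.π ℂ ℂ (ComplexPoints X) (2 * p) (cocycleOfRat (ComplexPoints X) (2 * p) ζ) = c →
    ∀ (K : Subfield ℂ) [Algebra.EssFiniteType ℤ K] (X₀ : SchemeOver K)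
      (hX₀ : IsSmoothProjective n X₀) (e : (baseChangeHom K.subtype).obj X₀ ≅ X)
      (ℓ : ℕ) [Fact ℓ.Prime],
      artinComparisonEquiv (E K ℓ) B K.subtype (C K ℓ) hX₀ (2 * p)
          ((1 : ℚ_[ℓ]) ⊗ₜ[ℚ] B.W.pullback e.hom (2 * p) t) ∈ (E K ℓ).tateClasses X₀ p

/-- (A′) AUTOMORPHIC SIDE + RESIDUE: on the sector (m ∈ {1,2}, `X` with a datum, HC in degree `2m`),
every rational Hodge `(n,n)`-class, `n = m+1`, is potentially Tate. [cite: Deligne1982HodgeCycles, Prop. 2.9(b)] -/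
def MiddleClassesPotentiallyTate : Prop :=
  ∀ (m : ℕ) (X : SchemeOver ℂ) (D : UnitaryBallQuotientDatum (2 * (m + 1)) X), 1 ≤ m → m ≤ 2 →
    (∀ a : complexBetti X (2 * m), IsRationalClass a →
      IsOfHodgeType (2 * (m + 1)) X (2 * m) m m a → a ∈ algebraicClasses X m) →
    ∀ c : complexBetti X (2 * (m + 1)), IsRationalClass c →
      IsOfHodgeType (2 * (m + 1)) X (2 * (m + 1)) (m + 1) (m + 1) c →
      IsPotentiallyTateClass E B C (2 * (m + 1)) X (m + 1) c

/-- (B) p-ADIC SIDE: on the sector, potentially Tate rational Hodge `(n,n)`-classes are algebraic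
(the target of Tate-line seeding: Xiao–Zhu seeds + Bloch–Esnault–Kerz + ALG).
[cite: BlochEsnaultKerz2014pAdic, Thm. 1.3] [cite: XiaoZhu2017, §1.1] -/
def PotentiallyTateMiddleClassesAlgebraic : Prop :=
  ∀ (m : ℕ) (X : SchemeOver ℂ) (D : UnitaryBallQuotientDatum (2 * (m + 1)) X), 1 ≤ m → m ≤ 2 →
    (∀ a : complexBetti X (2 * m), IsRationalClass a →
      IsOfHodgeType (2 * (m + 1)) X (2 * m) m m a → a ∈ algebraicClasses X m) →
    ∀ c : complexBetti X (2 * (m + 1)), IsRationalClass c →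
      IsOfHodgeType (2 * (m + 1)) X (2 * (m + 1)) (m + 1) (m + 1) c →
      IsPotentiallyTateClass E B C (2 * (m + 1)) X (m + 1) c →
      c ∈ algebraicClasses X (m + 1)

/-- The variety-level tree predicate implies the class-level sector statement (A′).
[cite: Deligne1982HodgeCycles, Prop. 2.9(b)] -/
theorem middleClassesPotentiallyTate_of_hodgeClassesArePotentiallyTate
    (h : ∀ (m : ℕ) (X : SchemeOver ℂ), Nonempty (UnitaryBallQuotientDatum (2 * (m + 1)) X) →
      HodgeClassesArePotentiallyTate E B C (2 * (m + 1)) X) :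
    MiddleClassesPotentiallyTate E B C := by
  intro m X D _ _ _ c hc hH t ζ ht hζ K _ X₀ hX₀ e ℓ _
  exact h m X ⟨D⟩ (m + 1) c hc hH t ζ ht hζ K X₀ hX₀ e ℓ

/-- (A′) ∧ (B) ⟹ middle-degree HC on the sector (pointwise). [cite: Tate1994, §1] -/
theorem middleHC_of_potentiallyTate (hA : MiddleClassesPotentiallyTate E B C)
    (hB : PotentiallyTateMiddleClassesAlgebraic E B C)
    (m : ℕ) (X : SchemeOver ℂ) (D : UnitaryBallQuotientDatum (2 * (m + 1)) X) (hm1 : 1 ≤ m)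
    (hm2 : m ≤ 2)
    (hlow : ∀ a : complexBetti X (2 * m), IsRationalClass a →
      IsOfHodgeType (2 * (m + 1)) X (2 * m) m m a → a ∈ algebraicClasses X m)
    (c : complexBetti X (2 * (m + 1))) (hc : IsRationalClass c)
    (hH : IsOfHodgeType (2 * (m + 1)) X (2 * (m + 1)) (m + 1) (m + 1) c) :
    c ∈ algebraicClasses X (m + 1) :=
  hB m X D hm1 hm2 hlow c hc hH (hA m X D hm1 hm2 hlow c hc hH)

/-- **The re-cut concludes the crux BY NAME**: (A′) → (B) → `AlgebraicOrEnveloped`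
(the crux's first disjunct suffices: `Submodule.mem_sup_left`, standing Disproof F1).
[cite: Deligne2000, §1] -/
theorem algebraicOrEnveloped_of_potentiallyTate (hA : MiddleClassesPotentiallyTate E B C)
    (hB : PotentiallyTateMiddleClassesAlgebraic E B C) : AlgebraicOrEnveloped :=
  fun m X D hm1 hm2 hlow c hc hH ↦
    Submodule.mem_sup_left (middleHC_of_potentiallyTate E B C hA hB m X D hm1 hm2 hlow c hc hH)

/-- The re-cut also gives the route TARGET directly (no envelope, no orientation family, no `γ`).
[cite: Deligne2000, §1] -/
theorem middleDegreeStep_of_potentiallyTate (hA : MiddleClassesPotentiallyTate E B C)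
    (hB : PotentiallyTateMiddleClassesAlgebraic E B C) : MiddleDegreeStep := by
  intro m X hm1 hm2 hD hlow c hc hH
  obtain ⟨D⟩ := hD
  exact middleHC_of_potentiallyTate E B C hA hB m X D hm1 hm2 hlow c hc hH

/-- Conversely (B) is HC-implied on the sector (no kill short of ¬HC, as for the crux itself: F1).
[cite: Deligne2000, §1] -/
theorem potentiallyTateMiddleClassesAlgebraic_of_hodgeConjecture (hHC : _root_.HodgeConjecture) :
    PotentiallyTateMiddleClassesAlgebraic E B C :=
  fun m _ D _ _ _ c hc hH _ ↦ (hHC D.isSmoothProjective).2 (m + 1) c hc hH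

end Summit.HodgeConjecture.HodgeConjecture.Cruxes.AlgebraicOrEnveloped.IdeatorFour

end
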